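import Summits.BirchSwinnertonDyer.Rank1Residual.Additive.CyclotomicTowerSignedLocal
import Literature.NumberTheory.EllipticCurves.SelmerPInftyRelModelAction
import HarnessLib

/-!
# Kobayashi's `Sel^±(E/K_n)`, `Sel^±(E/K_∞)` over `K_n = ℚ(ζ_{p^{n+1}})` (Def. 2.1) INSIDE `Γ_K`,
# the `η`-component `Sel^±(E/K_∞)^η` for a quadratic character `η` of `Δ`, and the dual
# `X^±(E/K_∞)^η` as a hypothesis structure
# (cell `b2b-bsdres`, CLASS-CLOSURE lane, seat cc-typer-6 GEN 8; the (B′) OBJECT of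
# `cells/n1011/skel/T-O7ss-P13-DISCHARGE-SCOPING.md` §1 — FILE 2 of 3, the GLOBAL part; FILE 1 =
# `CyclotomicTowerSignedLocal.lean`, FILE 3 = `CyclotomicTowerSignedSelmerDual.lean` (existence))

HONEST FRAMING (cell `b2b-bsdres`, run/shared/lean/b2b/bsd-rank1-residual/, verbatim in every
file): the goal of the cell is to DELETE the COMBINATION-SHAPED residual classes of the
Birch–Swinnerton-Dyer formula for ALL analytic-rank `≤ 1` elliptic curves over `ℚ` — "full BSD
formula for every rank `≤ 1` curve in class `C`" assembled STRICTLY from published theorems — so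
that the rank-`≤ 1` remainder becomes exactly the CONSTRUCTION-SHAPED classes, which are TYPED
(missing-input `Prop`s), NOT attempted. This is not "finishing BSD". CLASS-CLOSURE lane: prove
what is provable now; shrink each hard class to its core with data; no claim beyond stated classes;
research routes; census output = EVIDENCE / conjecture items, never a Literature fact;
RESIDUAL-MAP marks change only by signed lines. O7-ss stays OPEN, X4 CONSTRUCTION-SHAPED; nothing
here is booked; no label moves. VOCABULARY ONLY: definitions with bodies + PROVED unfolding /
stability lemmas + ONE hypothesis structure (field for field the tree's
`Kobayashi2003.SignedSelmerDualData` / additive-p1's `ChiEigenSelmerDualData`); NOTHING is asserted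
(Thm. 2.2 / 4.1 / 7.4, Kitajima–Otsuki are NOT stated); no named Literature fact; no `sorry`.

## Source, verbatim (Kobayashi, Invent. Math. 152 (2003) [Kobayashi2003], held copy
`paper:doi-10-1007-s00222-002-0265-4`, pp. 4, 5, 6, 8; page-checked by n1011-lit LIT-INPUTS-P3 §54)

p. 4: "`K_n = ℚ(ζ_{p^{n+1}})`, `K_{−1} = ℚ` and `K_∞ = ∪_n K_n`. … We regard `E(K_{n,v}) ⊗ ℚ_p/ℤ_p` as
a subgroup of `H¹(K_{n,v}, E[p^∞])` by the Kummer map." p. 5: "**Definition 2.1.** The even (odd)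
Selmer group is defined by `Sel^±(E/K_n) := Ker( H¹(K_n, E[p^∞]) → ∏_v H¹(K_{n,v}, E[p^∞]) /
E^±(K_{n,v}) ⊗ ℚ_p/ℤ_p )` and `Sel^±(E/K_∞) := lim→_n Sel^±(E/K_n)`. … We denote the Pontryagin
dual of Selmer groups by “X”. … `X^±(E/K_∞)` is the dual of `Sel^±(E/K_∞)`. Let `G_n = Gal(K_n/ℚ)`
and `G_∞ = lim← G_n`. Then … `Λ = ℤ_p[[G_∞]]` [acts] on `X^±(E/K_∞)`." p. 5: "`G_∞ = Δ × Γ`, where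
`Δ ≅ ℤ/(p−1)ℤ` and `Γ ≅ ℤ_p`. We fix a topological generator `γ ∈ Γ`. Then we identify `ℤ_p[[Γ]]`
with `ℤ_p[[X]]` … by identifying `γ` with `1 + X`." p. 6: "Let `η : Δ → ℤ_p^×` be a character …
We regard `η` as a character of `G_∞` by taking `η(γ) = 1`." p. 8: "For a `ℤ_p[Δ]`-module `M`,
let `M^η` denote the `η`-component of `M`. If we denote `ε_η = (1/♯Δ) ∑_{τ∈Δ} η^{−1}(τ) τ`, `M^η` is
given by `ε_η M`. … By Theorem 2.2, `X^±(E/K_∞)^η` is a torsion `ℤ_p[[Γ]]`-module."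

## Transcription INSIDE `Γ_K` (the additive-p1 `chiEigenSelmer` device; no second base field)

General data: a number field `K`, `κ : ZpExtension K p` (`K_n^κ`, `K_∞^κ`), a number field `K₀/K`
with `Gal(K̄/K₀) = galRange K₀` NORMAL in `Γ_K` (instance hypothesis, as in `TwistDescent`), a
model `E` of the completion of `K` at the place above `p`. Kobayashi: `K = ℚ`, `κ` cyclotomic,
`K₀ = ℚ(μ_p)`, `E = ℚ_[p]`; then `K₀·ℚ_n = ℚ(ζ_{p^{n+1}}) = K_n`, `K₀·ℚ_∞ = K_∞`, and
`Δ = Gal(K_0/ℚ) ≅ Gal(K_∞/ℚ_∞) = ker κ / (ker κ ⊓ galRange K₀)`.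
* `towerSubgroup κ K₀ n = κ.layerSubgroup n ⊓ galRange K₀ = Gal(K̄/K₀·K_n^κ)` (Kobayashi's
  `Gal(ℚ̄/K_n)`), `towerTopSubgroup κ K₀ = ker κ ⊓ galRange K₀ = Gal(K̄/K₀·K_∞^κ)` (`Gal(ℚ̄/K_∞)`);
  normal, the layers of finite index, `towerTopSubgroup ≤ towerSubgroup n`.
* `towerSignedSelmerLayer W κ K₀ E ε n = Sel^ε(E/K_n)` — Def. 2.1: the classical Selmer group of
  the fixed field of `towerSubgroup n` (`selmerGroupOver`, all places) cut, at the model `E` and every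
  `Γ_K`-conjugate (every place of `K_n` above that place — ONE for Kobayashi, `K_n/ℚ` totally
  ramified at `p`), to the classes whose restriction lies in the Kummer image of FILE 1's
  `E^ε(K_{n,v})` WITH the `m = −1` clause (`towerSignedLocalPointsOfEmb`); at `v ∤ p` the signed and
  the classical condition are both "`= 0`" (`E(K_{n,v}) ⊗ ℚ_p/ℤ_p = 0`), so imposing the signed
  condition above `p` only IS Def. 2.1. `towerSignedSelmerInfty = Sel^ε(E/K_∞) = ⋃_n` images
  (`resOfLe`). PROVED: `≤` the classical groups; stability under `conj_γ`, all `γ ∈ Γ_K`.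
* `towerSignedSelmerInftyEta W κ K₀ E η ε = Sel^ε(E/K_∞)^η` for a character
  `η : Γ_K →* ℤˣ` (read on `ker κ = Gal(K̄/K_∞^κ) ↠ Δ`): the classes `s` with
  `conj_σ s = η(σ)·s` for all `σ ∈ ker κ` — `ε_η M` for `M = Sel^ε(E/K_∞)` and `η` of order `≤ 2`
  (`η = η⁻¹`; Kobayashi's ODD-branch character `η = ω^{(p−1)/2}`, the character of `ℚ(√p*) ⊂ K₀`,
  is the instance; `η = 1` gives `M^Δ`). TODO(general form): `η` of order dividing `p − 1` with values
  in `ℤ_p^×` needs a `ℤ_p`-module structure on `H¹` that the tree does not carry; NOT faked here.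
* `EtaSignedSelmerDualData W κ K₀ E η γ ε` — `X^ε(E/K_∞)^η = Hom(Sel^ε(E/K_∞)^η, ℚ_p/ℤ_p)` as a
  `Λ = ℤ_p⟦T⟧`-module, `T ↔ conj_γ − 1` for `γ ∈ Gal(K̄/K₀)` with `κ γ` a generator ("`γ ∈ Γ`",
  "`γ` with `1 + X`"), field for field `ChiEigenSelmerDualData` + `conj_mem`; `charIdeal`, `mu`,
  `lambda`. EXISTENCE (non-vacuity) is FILE 3. For `η² = 1` the two conventions for the `Δ`-action
  on the dual (`x ∘ τ` vs `x ∘ τ⁻¹`) give the same `η`-component.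

References: [Kobayashi2003] §2 p. 4, Def. 2.1 (p. 5), §3 p. 5–6, §4 p. 8; [GreenbergLNM1716] §1
(p. 60); additive-p1 `AdditivePotMult/TwistDescent.lean` (`chiEigenSelmer`), p17
`Additive/StrictSignedSelmer.lean` (the `W`-coordinate avatar this object is to be compared with by
n1011-p17's (P5) dictionary — NOT here).
-/

noncomputable section

open scoped Classical

universe u

namespace Summit.BirchSwinnertonDyer.Rank1Residual.Additive

open Literature.NumberTheory.EllipticCurves Literature.NumberTheory.GaloisRepresentations
  Literature.NumberTheory.EllipticCurves.Kobayashi2003 ZpExtension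

/-! ## §1 The tower `Gal(K̄/K₀·K_n)` inside `Γ_K` -/

section Tower

variable {K : Type u} [Field K] {p : ℕ} [Fact p.Prime] (κ : ZpExtension K p)
  (K₀ : Type u) [Field K₀] [Algebra K K₀]

/-- **`Gal(K̄/K₀·K_n^κ) = κ⁻¹(pⁿℤ_p) ⊓ Gal(K̄/K₀)`** — for `K = ℚ`, `κ` cyclotomic, `K₀ = ℚ(μ_p)`:
`Gal(ℚ̄/K_n)`, `K_n = ℚ(ζ_{p^{n+1}}) = ℚ(μ_p)·ℚ_n`. [cite: Kobayashi2003, §2 p. 4 (the tower K_n)] -/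
def towerSubgroup (n : ℕ) : Subgroup (Field.absoluteGaloisGroup K) :=
  κ.layerSubgroup n ⊓ galRange (K := K) K₀

/-- **`Gal(K̄/K₀·K_∞^κ) = ker κ ⊓ Gal(K̄/K₀)`** — Kobayashi's `Gal(ℚ̄/K_∞)`, `K_∞ = ∪_n K_n`.
[cite: Kobayashi2003, §2 p. 4 (K_∞)] -/
def towerTopSubgroup : Subgroup (Field.absoluteGaloisGroup K) :=
  κ.kerSubgroup ⊓ galRange (K := K) K₀

/-- Membership in `towerSubgroup`. [cite: Kobayashi2003, §2 p. 4] -/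
theorem mem_towerSubgroup_iff (n : ℕ) (σ : Field.absoluteGaloisGroup K) :
    σ ∈ towerSubgroup κ K₀ n ↔ σ ∈ κ.layerSubgroup n ∧ σ ∈ galRange (K := K) K₀ :=
  Subgroup.mem_inf

/-- Membership in `towerTopSubgroup`. [cite: Kobayashi2003, §2 p. 4] -/
theorem mem_towerTopSubgroup_iff (σ : Field.absoluteGaloisGroup K) :
    σ ∈ towerTopSubgroup κ K₀ ↔ σ ∈ κ.kerSubgroup ∧ σ ∈ galRange (K := K) K₀ :=
  Subgroup.mem_inf

/-- `K_n ⊆ K_∞`: `towerTopSubgroup ≤ towerSubgroup n`. [cite: Kobayashi2003, §2 p. 4] -/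
theorem towerTopSubgroup_le (n : ℕ) : towerTopSubgroup κ K₀ ≤ towerSubgroup κ K₀ n :=
  inf_le_inf_right _ (κ.kerSubgroup_le_layerSubgroup n)

/-- `K_m ⊆ K_n` for `m ≤ n`: the tower decreases. [cite: Kobayashi2003, §2 p. 4] -/
theorem towerSubgroup_antitone : Antitone (towerSubgroup κ K₀) :=
  fun _ _ h => inf_le_inf_right _ (κ.layerSubgroup_antitone h)

/-- `towerSubgroup n ≤ Gal(K̄/K₀)` and `towerTopSubgroup ≤ ker κ`. [cite: Kobayashi2003, §2 p. 4] -/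
theorem towerSubgroup_le_galRange (n : ℕ) : towerSubgroup κ K₀ n ≤ galRange (K := K) K₀ :=
  inf_le_right

/-- `towerTopSubgroup ≤ ker κ` (`K_∞^κ ⊆ K₀·K_∞^κ`). [cite: Kobayashi2003, §2 p. 4] -/
theorem towerTopSubgroup_le_kerSubgroup : towerTopSubgroup κ K₀ ≤ κ.kerSubgroup :=
  inf_le_left

/-- `κ⁻¹(pⁿℤ_p)` has finite index (`pⁿ`, `index_layerSubgroup`). [folklore] -/
instance finiteIndex_layerSubgroup' (n : ℕ) : (κ.layerSubgroup n).FiniteIndex :=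
  ⟨by rw [κ.index_layerSubgroup n]; exact pow_ne_zero n (Fact.out : p.Prime).ne_zero⟩

section Normal

variable [(galRange (K := K) K₀).Normal]

/-- The layers are normal in `Γ_K` (`K₀·K_n/K` Galois when `K₀/K` is). [folklore] -/
instance normal_towerSubgroup (n : ℕ) : (towerSubgroup κ K₀ n).Normal := by
  unfold towerSubgroup; infer_instance

/-- `Gal(K̄/K₀·K_∞)` is normal in `Γ_K`. [folklore] -/
instance normal_towerTopSubgroup : (towerTopSubgroup κ K₀).Normal := by
  unfold towerTopSubgroup; infer_instance

end Normal

variable [NumberField K] [NumberField K₀]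

/-- `Gal(K̄/K₀)` has finite index (`RelModel.finiteIndex_galRange`). [folklore] -/
instance finiteIndex_galRange' : (galRange (K := K) K₀).FiniteIndex :=
  RelModel.finiteIndex_galRange (K := K) K₀

/-- The layers `Gal(K̄/K₀·K_n)` have finite index. [folklore] -/
instance finiteIndex_towerSubgroup (n : ℕ) : (towerSubgroup κ K₀ n).FiniteIndex := by
  unfold towerSubgroup; infer_instance

end Tower

/-! ## §2 `Sel^ε(E/K_n)` and `Sel^ε(E/K_∞)` (Definition 2.1) -/

section Selmer

variable {K : Type u} [Field K] [NumberField K] (W : WeierstrassCurve K) {p : ℕ} [Fact p.Prime]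
  (κ : ZpExtension K p) (K₀ : Type u) [Field K₀] [NumberField K₀] [Algebra K K₀]
  (E : Type u) [Field E] [Algebra K E] [(galRange (K := K) K₀).Normal]

/-- **`Sel^ε(E/K_n)`**, Def. 2.1: `Ker( H¹(K_n, E[p^∞]) → ∏_v H¹(K_{n,v}, E[p^∞]) / E^ε(K_{n,v}) ⊗
ℚ_p/ℤ_p )` — the classical `Sel_{p^∞}` of the fixed field of `towerSubgroup κ K₀ n`
(`selmerGroupOver`) cut down, at the model `E` of the completion above `p` and every `Γ_K`-conjugate
(`conj_σ`: every place of `K_n` above it), to the classes whose local restriction lies in the Kummer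
image of `E^ε(K_{n,v})` WITH the `m = −1` clause (FILE 1, `towerSignedLocalPointsOfEmb`).
[cite: Kobayashi2003, Def. 2.1 (p. 5)] -/
def towerSignedSelmerLayer (ε : ℤˣ) (n : ℕ) : AddSubgroup (W.subgroupH1 p (towerSubgroup κ K₀ n)) :=
  W.selmerGroupOver p (towerSubgroup κ K₀ n) ⊓
    ⨅ (σ : Field.absoluteGaloisGroup K),
      (localKummerOverOfEmb W p (towerSubgroup κ K₀ n) (closureEmb (K := K) E)
          (towerSignedLocalPointsOfEmb (towerSubgroup κ K₀) (closureEmb (K := K) E) W ε n)).comap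
        (W.conjH1 p (towerSubgroup κ K₀ n) σ)

/-- Membership in `Sel^ε(E/K_n)`. [cite: Kobayashi2003, Def. 2.1 (p. 5)] -/
theorem mem_towerSignedSelmerLayer_iff (ε : ℤˣ) (n : ℕ)
    (c : W.subgroupH1 p (towerSubgroup κ K₀ n)) :
    c ∈ towerSignedSelmerLayer W κ K₀ E ε n ↔ c ∈ W.selmerGroupOver p (towerSubgroup κ K₀ n) ∧
      ∀ σ : Field.absoluteGaloisGroup K,
        W.conjH1 p (towerSubgroup κ K₀ n) σ c ∈
          localKummerOverOfEmb W p (towerSubgroup κ K₀ n) (closureEmb (K := K) E)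
            (towerSignedLocalPointsOfEmb (towerSubgroup κ K₀) (closureEmb (K := K) E) W ε n) := by
  simp only [towerSignedSelmerLayer, AddSubgroup.mem_inf, AddSubgroup.mem_iInf, AddSubgroup.mem_comap]

/-- `Sel^ε(E/K_n) ≤ Sel_{p^∞}(E/K_n)`. [cite: Kobayashi2003, Def. 2.1 (p. 5)] -/
theorem towerSignedSelmerLayer_le_selmerGroupOver (ε : ℤˣ) (n : ℕ) :
    towerSignedSelmerLayer W κ K₀ E ε n ≤ W.selmerGroupOver p (towerSubgroup κ K₀ n) :=
  inf_le_left

/-- The signed condition at the chosen embedding itself (`σ = 1`).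
[cite: Kobayashi2003, Def. 2.1 (p. 5)] -/
theorem mem_localKummerOverOfEmb_of_mem_towerSignedSelmerLayer (ε : ℤˣ) (n : ℕ)
    {c : W.subgroupH1 p (towerSubgroup κ K₀ n)} (hc : c ∈ towerSignedSelmerLayer W κ K₀ E ε n) :
    c ∈ localKummerOverOfEmb W p (towerSubgroup κ K₀ n) (closureEmb (K := K) E)
      (towerSignedLocalPointsOfEmb (towerSubgroup κ K₀) (closureEmb (K := K) E) W ε n) := by
  have h := ((mem_towerSignedSelmerLayer_iff W κ K₀ E ε n c).mp hc).2 1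
  rwa [W.conjH1_one_holds p (towerSubgroup κ K₀ n), AddMonoidHom.id_apply] at h

/-- **`Sel^ε(E/K_∞) := lim→_n Sel^ε(E/K_n)`** inside `H¹(K_∞, E[p^∞])` (`K_∞ = K₀·K_∞^κ`): the union
of the images under the restrictions `H¹(K_n, ·) → H¹(K_∞, ·)` (`resOfLe`, `towerTopSubgroup_le`).
[cite: Kobayashi2003, Def. 2.1 (p. 5)] -/
def towerSignedSelmerInfty (ε : ℤˣ) : AddSubgroup (W.subgroupH1 p (towerTopSubgroup κ K₀)) :=
  ⨆ n : ℕ, (towerSignedSelmerLayer W κ K₀ E ε n).map (W.resOfLe p (towerTopSubgroup_le κ K₀ n))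

/-- Each `Sel^ε(E/K_n)` maps into `Sel^ε(E/K_∞)`. [cite: Kobayashi2003, Def. 2.1 (p. 5)] -/
theorem map_resOfLe_towerSignedSelmerLayer_le (ε : ℤˣ) (n : ℕ) :
    (towerSignedSelmerLayer W κ K₀ E ε n).map (W.resOfLe p (towerTopSubgroup_le κ K₀ n)) ≤
      towerSignedSelmerInfty W κ K₀ E ε :=
  le_iSup (fun n => (towerSignedSelmerLayer W κ K₀ E ε n).map
    (W.resOfLe p (towerTopSubgroup_le κ K₀ n))) n

/-- `Sel^ε(E/K_n)` is stable under the conjugation action of `Γ_K`: the classical part by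
`map_conjH1_selmerGroupOver_le_holds`, the signed conditions because `conj_σ ∘ conj_γ = conj_{σγ}`
permutes them (`conjH1_mul_holds`) — word for word `conjH1_mem_signedSelmerLayer`.
[cite: Kobayashi2003, Def. 2.1 (p. 5)] -/
theorem conjH1_mem_towerSignedSelmerLayer (ε : ℤˣ) (n : ℕ) (γ : Field.absoluteGaloisGroup K)
    {c : W.subgroupH1 p (towerSubgroup κ K₀ n)} (hc : c ∈ towerSignedSelmerLayer W κ K₀ E ε n) :
    W.conjH1 p (towerSubgroup κ K₀ n) γ c ∈ towerSignedSelmerLayer W κ K₀ E ε n := by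
  rw [mem_towerSignedSelmerLayer_iff] at hc ⊢
  refine ⟨W.map_conjH1_selmerGroupOver_le_holds p (towerSubgroup κ K₀ n) γ ⟨c, hc.1, rfl⟩,
    fun σ => ?_⟩
  rw [← AddMonoidHom.comp_apply,
    ← conjH1_mul_holds (towerSubgroup κ K₀ n) (W.geomPrimaryTorsion p) σ γ]
  exact hc.2 (σ * γ)

/-- **`Sel^ε(E/K_∞)` is stable under the conjugation action of `Γ_K`** — the action through which
`Λ = ℤ_p[[G_∞]]` "acts naturally" on the dual (p. 5); restriction commutes with conjugation
(`resOfLe_comp_conjH1_holds`). [cite: Kobayashi2003, Def. 2.1 (p. 5)] -/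
theorem conjH1_mem_towerSignedSelmerInfty (ε : ℤˣ) (γ : Field.absoluteGaloisGroup K)
    {s : W.subgroupH1 p (towerTopSubgroup κ K₀)} (hs : s ∈ towerSignedSelmerInfty W κ K₀ E ε) :
    W.conjH1 p (towerTopSubgroup κ K₀) γ s ∈ towerSignedSelmerInfty W κ K₀ E ε := by
  refine AddSubgroup.iSup_induction
    (fun n => (towerSignedSelmerLayer W κ K₀ E ε n).map (W.resOfLe p (towerTopSubgroup_le κ K₀ n)))
    (C := fun s => W.conjH1 p (towerTopSubgroup κ K₀) γ s ∈ towerSignedSelmerInfty W κ K₀ E ε)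
    hs ?_ ?_ ?_
  · rintro n s ⟨c, hc, rfl⟩
    refine map_resOfLe_towerSignedSelmerLayer_le W κ K₀ E ε n
      ⟨W.conjH1 p (towerSubgroup κ K₀ n) γ c, conjH1_mem_towerSignedSelmerLayer W κ K₀ E ε n γ hc, ?_⟩
    change ((W.resOfLe p (towerTopSubgroup_le κ K₀ n)).comp
        (W.conjH1 p (towerSubgroup κ K₀ n) γ)) c = _
    rw [resOfLe_comp_conjH1_holds]
    rfl
  · rw [map_zero]; exact zero_mem _
  · intro s t hs ht; rw [map_add]; exact add_mem hs ht

/-! ## §3 The `η`-component `Sel^ε(E/K_∞)^η` -/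

variable (η : Field.absoluteGaloisGroup K →* ℤˣ)

/-- **`Sel^ε(E/K_∞)^η = ε_η Sel^ε(E/K_∞)`** for a character `η : Γ_K →* ℤˣ` (values `±1`, read on
`ker κ = Gal(K̄/K_∞^κ)`, which surjects onto `Δ = Gal(K_∞/K_∞^κ) ≅ Gal(K_0/K)`): the classes
`s ∈ Sel^ε(E/K_∞)` with `conj_σ s = η(σ)·s` for every `σ ∈ ker κ` (p. 8: "`M^η` … is given by
`ε_η M`"; for `η` of order `≤ 2` the `η`-eigenspace). `η = ω^{(p−1)/2}`, the character of
`ℚ(√p*) ⊂ ℚ(μ_p)`, is Kobayashi's odd-branch instance; `η = 1` gives `Sel^ε(E/K_∞)^Δ`. An additive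
subgroup. TODO(general form): `η : Δ → ℤ_p^×` of order `∣ p − 1`. [cite: Kobayashi2003, §4 p. 8 (M^η = ε_η M) and §3 p. 6 (η(γ) = 1)] -/
def towerSignedSelmerInftyEta (ε : ℤˣ) : AddSubgroup (W.subgroupH1 p (towerTopSubgroup κ K₀)) where
  carrier := {s | s ∈ towerSignedSelmerInfty W κ K₀ E ε ∧
    ∀ σ ∈ κ.kerSubgroup, W.conjH1 p (towerTopSubgroup κ K₀) σ s = ((η σ : ℤˣ) : ℤ) • s}
  zero_mem' := ⟨zero_mem _, fun σ _ => by rw [map_zero, zsmul_zero]⟩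
  add_mem' := fun {a b} ha hb =>
    ⟨add_mem ha.1 hb.1, fun σ hσ => by rw [map_add, ha.2 σ hσ, hb.2 σ hσ, zsmul_add]⟩
  neg_mem' := fun {a} ha => ⟨neg_mem ha.1, fun σ hσ => by rw [map_neg, ha.2 σ hσ, zsmul_neg]⟩

/-- Membership in `Sel^ε(E/K_∞)^η`. [cite: Kobayashi2003, §4 p. 8] -/
theorem mem_towerSignedSelmerInftyEta_iff (ε : ℤˣ) (s : W.subgroupH1 p (towerTopSubgroup κ K₀)) :
    s ∈ towerSignedSelmerInftyEta W κ K₀ E η ε ↔ s ∈ towerSignedSelmerInfty W κ K₀ E ε ∧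
      ∀ σ ∈ κ.kerSubgroup,
        W.conjH1 p (towerTopSubgroup κ K₀) σ s = ((η σ : ℤˣ) : ℤ) • s :=
  Iff.rfl

/-- `Sel^ε(E/K_∞)^η ≤ Sel^ε(E/K_∞)`. [cite: Kobayashi2003, §4 p. 8] -/
theorem towerSignedSelmerInftyEta_le (ε : ℤˣ) :
    towerSignedSelmerInftyEta W κ K₀ E η ε ≤ towerSignedSelmerInfty W κ K₀ E ε :=
  fun _ hs => hs.1

/-- **`Sel^ε(E/K_∞)^η` is stable under `conj_γ` for EVERY `γ ∈ Γ_K`**: `conj_σ conj_γ =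
conj_γ conj_{γ⁻¹σγ}` (`conjH1_mul_holds`), `γ⁻¹σγ ∈ ker κ` (normal) and `η(γ⁻¹σγ) = η(σ)` (`ℤˣ`
is commutative) — so `Λ = ℤ_p[[Γ]]` acts on the `η`-component; discharges the field `conj_mem` of
`EtaSignedSelmerDualData`. [cite: Kobayashi2003, §4 p. 8 (X^±(E/K_∞)^η a ℤ_p[[Γ]]-module)] -/
theorem conjH1_mem_towerSignedSelmerInftyEta (ε : ℤˣ) (γ : Field.absoluteGaloisGroup K)
    {s : W.subgroupH1 p (towerTopSubgroup κ K₀)} (hs : s ∈ towerSignedSelmerInftyEta W κ K₀ E η ε) :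
    W.conjH1 p (towerTopSubgroup κ K₀) γ s ∈ towerSignedSelmerInftyEta W κ K₀ E η ε := by
  refine ⟨conjH1_mem_towerSignedSelmerInfty W κ K₀ E ε γ hs.1, fun σ hσ => ?_⟩
  have hσ' : γ⁻¹ * σ * γ ∈ κ.kerSubgroup := κ.kerSubgroup_normal.conj_mem' σ hσ γ
  have h1 : W.conjH1 p (towerTopSubgroup κ K₀) σ (W.conjH1 p (towerTopSubgroup κ K₀) γ s) =
      W.conjH1 p (towerTopSubgroup κ K₀) γ
        (W.conjH1 p (towerTopSubgroup κ K₀) (γ⁻¹ * σ * γ) s) := by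
    rw [← AddMonoidHom.comp_apply, ← W.conjH1_mul_holds p, ← AddMonoidHom.comp_apply,
      ← W.conjH1_mul_holds p, ← mul_assoc, ← mul_assoc, mul_inv_cancel, one_mul]
  rw [h1, hs.2 _ hσ', map_zsmul, map_mul, map_mul, map_inv, mul_right_comm, inv_mul_cancel, one_mul]

end Selmer

/-! ## §4 The Pontryagin dual `X^ε(E/K_∞)^η` as a hypothesis structure -/

section Dual

variable {K : Type u} [Field K] [NumberField K] {p : ℕ} [Fact p.Prime]

/-- **Pontryagin-dual data for `Sel^ε(E/K_∞)^η`** — field for field additive-p1's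
`ChiEigenSelmerDualData` (and the tree's `Kobayashi2003.SignedSelmerDualData`) for the
`η`-component: the Iwasawa module `X^ε(E/K_∞)^η = Hom(Sel^ε(E/K_∞)^η, ℚ_p/ℤ_p)` ("`X^±(E/K_∞)^η` is a
torsion `ℤ_p[[Γ]]`-module", p. 8 — torsion NOT asserted here) as an abstract `Λ = ℤ_p⟦T⟧`-module `X`
with `conj_mem` (stability under `conj_γ`, dischargeable by `conjH1_mem_towerSignedSelmerInftyEta`),
`toDual : X ≃ Hom(Sel^{ε,η}_∞, ℚ/ℤ)`, `T ↔ conj_γ − 1` for `γ ∈ Gal(K̄/K₀)` with `κ γ` a generator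
("we fix a topological generator `γ ∈ Γ`… identifying `γ` with `1 + X`", p. 5), constants through
`ℤ_p → ℤ/pᵏ`. For `K = ℚ`, `κ` cyclotomic, `K₀ = ℚ(μ_p)`, `E = ℚ_[p]`, `ε = −1`, `η = ω^{(p−1)/2}`:
the object `X⁻(E/K_∞)^η` of the ODD main conjecture / Thm. 4.1 third display. NOTHING about
existence (FILE 3), finite generation, torsion (Thm. 2.2) or finite submodules is asserted.
[cite: Kobayashi2003, Def. 2.1 (p. 5), §4 p. 8 (the object only)] [cite: GreenbergLNM1716, §1 (p. 60)] -/
structure EtaSignedSelmerDualData (W : WeierstrassCurve K) (κ : ZpExtension K p)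
    (K₀ : Type u) [Field K₀] [NumberField K₀] [Algebra K K₀] [(galRange (K := K) K₀).Normal]
    (E : Type u) [Field E] [Algebra K E] (η : Field.absoluteGaloisGroup K →* ℤˣ)
    (γ : Field.absoluteGaloisGroup K) (ε : ℤˣ) where
  /-- The underlying type of the Iwasawa module `X^ε(E/K_∞)^η`. -/
  X : Type u
  /-- `X` is an abelian group. -/
  [addCommGroup : AddCommGroup X]
  /-- `X` is a `Λ = ℤ_p⟦T⟧`-module. -/
  [module : Module (IwasawaAlgebra p) X]
  /-- `Sel^ε(E/K_∞)^η` is stable under conjugation by `γ` (holds by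
  `conjH1_mem_towerSignedSelmerInftyEta`). -/
  conj_mem : ∀ s ∈ towerSignedSelmerInftyEta W κ K₀ E η ε,
    W.conjH1 p (towerTopSubgroup κ K₀) γ s ∈ towerSignedSelmerInftyEta W κ K₀ E η ε
  /-- The identification of `X` with the character group `Hom(Sel^{ε,η}_∞, ℚ/ℤ)`. -/
  toDual : X →+ (towerSignedSelmerInftyEta W κ K₀ E η ε →+ AddCircle (1 : ℚ))
  /-- `toDual` is a group isomorphism. -/
  bijective : Function.Bijective toDual
  /-- `T` acts as `γ - 1`: `(T·x)(s) = x(conj_γ s) - x(s)`. -/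
  toDual_T_smul : ∀ (x : X) (s : towerSignedSelmerInftyEta W κ K₀ E η ε),
    toDual ((PowerSeries.X : IwasawaAlgebra p) • x) s =
      toDual x ⟨W.conjH1 p (towerTopSubgroup κ K₀) γ s, conj_mem s s.2⟩ - toDual x s
  /-- Constants `c ∈ ℤ_p` act on `pᵏ`-torsion classes through `ℤ_p → ℤ/pᵏ`. -/
  toDual_C_smul : ∀ (c : ℤ_[p]) (x : X) (s : towerSignedSelmerInftyEta W κ K₀ E η ε) (k : ℕ),
    (p ^ k) • s = 0 → toDual (PowerSeries.C c • x) s = (PadicInt.toZModPow k c).val • toDual x s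

namespace EtaSignedSelmerDualData

variable {W : WeierstrassCurve K} {κ : ZpExtension K p} {K₀ : Type u} [Field K₀] [NumberField K₀]
  [Algebra K K₀] [(galRange (K := K) K₀).Normal] {E : Type u} [Field E] [Algebra K E]
  {η : Field.absoluteGaloisGroup K →* ℤˣ} {γ : Field.absoluteGaloisGroup K} {ε : ℤˣ}

/-- The dual of a datum is an abelian group (instance on the new type `D.X`; no library instance is
touched). [cite: Kobayashi2003, §4 p. 8 (the object only)] -/
instance instAddCommGroupX (D : EtaSignedSelmerDualData W κ K₀ E η γ ε) : AddCommGroup D.X :=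
  D.addCommGroup

/-- The dual of a datum is a `Λ`-module (instance on `D.X`). [cite: Kobayashi2003, §4 p. 8 (the object only)] -/
instance instModuleX (D : EtaSignedSelmerDualData W κ K₀ E η γ ε) : Module (IwasawaAlgebra p) D.X :=
  D.module

variable (D : EtaSignedSelmerDualData W κ K₀ E η γ ε)

/-- The **characteristic ideal** `Char(X^ε(E/K_∞)^η) ⊆ ℤ_p[[Γ]]` (`Module.charIdeal`) — the object of
Kobayashi's main conjectures at `η` ("`Char(X⁻(E/K_∞)^η) = ((1/X)·L_p⁻(E, η, X))`" for `η ≠ 1`,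
§4 p. 8; NOT asserted). [cite: Kobayashi2003, §4 p. 8 (the object only)] -/
def charIdeal : Ideal (IwasawaAlgebra p) :=
  Literature.NumberTheory.EllipticCurves.Module.charIdeal (IwasawaAlgebra p) D.X

/-- The **`μ`-invariant** of `X^ε(E/K_∞)^η` (`muInvariant`; junk `0` unless finitely generated
torsion). [cite: Kobayashi2003, §4 p. 8 (the object only)] -/
def mu : ℕ :=
  muInvariant p D.X

/-- The **`λ`-invariant** of `X^ε(E/K_∞)^η` (`lambdaInvariant`; junk `0` unless finitely generated
torsion). [cite: Kobayashi2003, §4 p. 8 (the object only)] -/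
def lambda : ℕ :=
  lambdaInvariant p D.X

end EtaSignedSelmerDualData

end Dual

end Summit.BirchSwinnertonDyer.Rank1Residual.Additive

end
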